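import Literature.MathematicalPhysics.QuantumFieldTheory.Balaban1983to89.Node00.BgLettersOfRecord
import Literature.MathematicalPhysics.QuantumFieldTheory.Balaban1983to89.B11Prop6Concrete
import HarnessLib

/-!
# The background current `J(U₀)` OF RECORD in the `|·|₍₋₃₎`-carrier — the `J`-slot of the record instance of [Balaban1985Variational] Prop. 6 (M2 file 3d′)

statement-level skeleton of published definitions with citation tags; nothing here is a claim about the Yang–Mills mass gap
(cell `pub-ymgap`, unit `pub-ymgap-node00-def-Y` g36; Node00 = the record `(F : T4Family, SU(N), avOfRecord)`).

WHAT IS HERE (additive; nothing landed is changed; ONE definition, the rest unfolding ∕ instantiation).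
* §1 `JOfRecordAtBg F N K k Ω U₀ : NegSizeLit F N K k Ω 3` := lit's ✓`B11Eq98CurrentSlot.Jcur` AT THE RECORD's units-valued background
  `Node00.unitsOfRecord F N U₀` ([Balaban1985Variational] (27)–(28) «`J = D*η⁻² Im ∂U₀ = Im η⁻²D*∂U₀`» = [Balaban1985BackgroundPropagators] (3.11),
  in B9's letters `B9Eq39Adjoint.J Tsh (Ucur U₀) η`), read in the size `|·|₍₋₃₎` of [Balaban1985Variational] p. 286 on the record's lit carrier
  (`Node00.NegSizeLit` of file 3a = `B11Eq115Space.NegSize (F.L) (η_k) (bondLevLit F Ω k) 3 M_N(ℂ)`).  This is the TERM the `J`-slot of the record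
  instance of `BgSchemeOnLit F N K k Ω U₀` takes, and the letter in which lit's Prop. 6 at one background (✓`B11Prop6Concrete.exists_solution_concrete_H₁B`:
  «exactly one `A₁` in the ball (115) solves `A₁ + 𝔊(Jcur U₀) + 𝔊(W(A₁ + H₁B)) = 0`») is stated — so that theorem APPLIES at the record verbatim.
  Unfoldings `JOfRecordAtBg_eq` (rfl), `JOfRecordAtBg_apply` (bondwise: `J(b) = B9Eq39Adjoint.J Tsh (Ucur (unitsOfRecord U₀)) η b.2 b.1`, rfl).
* §2 the two HYPOTHESES of lit's (28)-bound DISCHARGED ∕ NAMED at the record: `isUnitaryBg_unitsOfRecord` (`B11Prop6Concrete.IsUnitaryBg`, i.e.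
  `U₀(b)⁻¹ = U₀(b)*` — SU(N), by `Node00.coe_unitsOfRecord_inv`), `ucur_unitsOfRecord_inv_eq_star` (the same in B9's `(direction, site)` letters);
  the FIBRE FACT `star_JOfRecordAtBg_apply` («`J(b)* = J(b)`»: `B11Eq27Current.J_eq_imPart_div` + `star_imPart`); and **(28) AT THE RECORD**
  `norm_JOfRecordAtBg_le`: `‖J(U₀)‖₍₋₃₎ ≤ C₁B₃ε₁` from the current clause of (2)∕(14) read bondwise, DISPLAYED as lit's named hypothesis
  `B11Prop6Concrete.InU2cur (F.L) (η_k) (bondLevLit F Ω k) (C₁B₃ε₁) (unitsOfRecord F N U₀)` (= ✓`B11Eq98CurrentSlot.norm_Jcur_le` instantiated; the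
  derivation of `InU2cur` from the record's regime `Node00.bgReg` ∕ (14) is the cell's N07 ∕ porter glue and is NOT done here).
* §3 E1 (the letter at the unit background): `unitsOfRecord_one` and `JOfRecordAtBg_one` — **`J(1) = 0`** (every plaquette variable is `1`, `Im 1 = 0`;
  the first-order term of (26) is absent at a flat background), the inhabited instance the cell's E-guard asks next to each pinned letter (proof recipe
  located by the cell's second reader RR-2).

DICTIONARY (record ↦ lit, all from file 3a `Node00.BgCarriersOfRecordLit` ∕ `Node00.BgLettersOfRecord`): bonds `PBond (F.P K) 0 ≃ Bond d Pd` by `bondToLit`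
(`Pd := fun _ ↦ (F.P K).sitesPerDir 0`), sites by `siteToLit`, shifts = lit's canonical `B11Eq90V0primeCurrent.Tsh := fun μ ↦ shiftEquiv μ`, background
`U₀ : GaugeField (F.P K) 0 (SU N)` ↦ `unitsOfRecord F N U₀ : Bond d Pd → M_N(ℂ)ˣ` ↦ `Ucur (unitsOfRecord F N U₀) μ x = unitsOfRecord F N U₀ (x, μ)`, fibre
`𝔸 = Matrix (Fin N) (Fin N) ℂ` with the `L²`-operator (C⋆) norm opened by `open scoped Matrix.Norms.L2Operator` (no instance declared here), `L := F.L`,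
`η := (F.P K).eta k`, levels `bondLevLit F Ω k`.

HONEST LABELS.  (1) DEFINITIONAL ∕ instantiation only: no estimate of the series is NEW here ((28) is lit's theorem under lit's named hypothesis).  (2) THIRD
SPELLING of the current at the record, by design: Node00 already carries `Node00.BackgroundCurrentShape.currentOfRecord` (the [Balaban1987RG1] (1.2) ∕ [Balaban1985Variational] (2)
current `D*_U η⁻² π Im ∂U` on `PBond`, `π`-projected, compared with B9's `J` in `Node00.BackgroundCurrentCompare.currentOfRecord_eq`), and the cell's N07 lane has
Sect. B at objects over `B9TorusCalculus.torusT` ∕ `cfgGL` (Summits side); the present letter is the `|·|₍₋₃₎`-typed reading over (`Tsh`, `Ucur ∘ unitsOfRecord`) that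
lit's Prop. 6 ∕ `W80` ∕ `V80` consume — the comparison lemmas («`JOfRecordAtBg` at `bondToLit b` = `currentOfRecord … b` up to the `𝔰𝔲`-projection `π`, which is the
identity on `Im(D*∂U₀)` at `N = 2`» and «`Tsh`∕`siteToLit` versus `torusT`») are NOT proved here and are owed as twin-diff items.  (3) TRACE: `J(b)` is Hermitian
(proved); `tr J(b) = 0` holds at the record `N = 2` (real traces in `SU(2)`) and is NOT proved here (E-item; for `N ≥ 3` print's `π` is needed).  (4) COUNT∕K
unchanged by this file; finite `𝕋⁴` at fixed `ε` throughout; nothing continuum ∕ OS ∕ Clay.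
-/

noncomputable section

open scoped Matrix.Norms.L2Operator InnerProductSpace ComplexConjugate

namespace Literature.MathematicalPhysics.QuantumFieldTheory.Balaban1983to89.Node00

open T4Continuum (T4Family)
open B4Sect5Torus (TSite)
open B9SectCLatticeCarrier (Bond)
open B11Eq115Space (Space115 NegSize NegSup levWeight)
open B11Eq90V0primeCurrent (Tsh Ucur curL)
open B11Eq98CurrentSlot (Jcur)
open B11Prop6Concrete (InU2cur IsUnitaryBg)

variable (F : T4Family) (N : ℕ) (K k : ℕ) (Ω : ℕ → Set (Site (F.P K) 0)) (U₀ : GaugeField (F.P K) 0 (SU N))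

/-- ★ **The current `J(U₀)` OF RECORD** ((27)–(28): `J = D*η⁻² Im ∂U₀`), read in the `|·|₍₋₃₎`-carrier of record: lit's `Jcur` at the record's
units-valued background `unitsOfRecord F N U₀` — the term of the `J`-slot of the record instance of Prop. 6's scheme.
[cite: Balaban1985Variational, (27)–(28) p.282, p.286] -/
def JOfRecordAtBg [Fact (0 < (F.L : ℝ))] [Fact (0 < (F.P K).eta k)] : NegSizeLit F N K k Ω 3 :=
  Jcur (L := (F.L : ℝ)) (η := (F.P K).eta k) (lev₀ := bondLevLit F Ω k) (unitsOfRecord F N U₀)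

variable {F N K k Ω U₀}

/-- Unfolding: `J` of record IS lit's `Jcur` at `unitsOfRecord`. [cite: Balaban1985Variational, (28) p.282] -/
theorem JOfRecordAtBg_eq [Fact (0 < (F.L : ℝ))] [Fact (0 < (F.P K).eta k)] :
    JOfRecordAtBg F N K k Ω U₀ = Jcur (L := (F.L : ℝ)) (η := (F.P K).eta k) (lev₀ := bondLevLit F Ω k) (unitsOfRecord F N U₀) := rfl

/-- Bondwise unfolding: `J(b) = (D^{η*}_{U₀} η⁻² Im ∂U₀)(b)` in B9's letters (`B9Eq39Adjoint.J`). [cite: Balaban1985Variational, (28) p.282] -/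
theorem JOfRecordAtBg_apply [Fact (0 < (F.L : ℝ))] [Fact (0 < (F.P K).eta k)]
    (b : Bond (F.P K).d (fun _ => (F.P K).sitesPerDir 0)) :
    NegSup.equiv (levWeight (F.L : ℝ) ((F.P K).eta k) (bondLevLit F Ω k) 3) (Matrix (Fin N) (Fin N) ℂ) (JOfRecordAtBg F N K k Ω U₀) b
      = B9Eq39Adjoint.J Tsh (Ucur (unitsOfRecord F N U₀)) ((F.P K).eta k) b.2 b.1 :=
  rfl

/-- The record's background is unitary-valued in lit's sense (`U₀(b)⁻¹ = U₀(b)*`: the hypothesis `hU` of lit's (28)), because it is `SU(N)`-valued.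
[cite: Balaban1985Variational, p.277] -/
theorem isUnitaryBg_unitsOfRecord : IsUnitaryBg (unitsOfRecord F N U₀) := by
  intro a
  exact coe_unitsOfRecord_inv U₀ a

/-- `Im X = (2i)⁻¹(X − X*)` is self-adjoint. [folklore] [cite: Balaban1985Variational, (28) p.282] -/
theorem star_imPart (X : Matrix (Fin N) (Fin N) ℂ) : star (B11Eq27Current.imPart X) = B11Eq27Current.imPart X := by
  have hc : star ((2 * Complex.I)⁻¹ : ℂ) = -((2 * Complex.I)⁻¹) := by
    rw [Complex.star_def, map_inv₀, map_mul, Complex.conj_I, map_ofNat]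
    rw [mul_neg, neg_inv]
  simp only [B11Eq27Current.imPart, star_smul, star_sub, star_star, hc, neg_smul, ← smul_neg, neg_sub]

/-- The background of record in B9's `(direction, site)` letters (`Ucur`) is unitary-valued. [cite: Balaban1985Variational, p.277] -/
theorem ucur_unitsOfRecord_inv_eq_star (μ : Fin (F.P K).d) (x : TSite (F.P K).d (fun _ => (F.P K).sitesPerDir 0)) :
    (((Ucur (unitsOfRecord F N U₀) μ x)⁻¹ : (Matrix (Fin N) (Fin N) ℂ)ˣ) : Matrix (Fin N) (Fin N) ℂ)
      = star (Ucur (unitsOfRecord F N U₀) μ x : Matrix (Fin N) (Fin N) ℂ) :=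
  isUnitaryBg_unitsOfRecord (F := F) (N := N) (U₀ := U₀) (x, μ)

/-- **`J` OF RECORD IS HERMITIAN BONDWISE** (`J(b)* = J(b)`: (28)'s form `J = η⁻² Im(D*∂U₀)` for the unitary background, and `Im` is
self-adjoint) — the fibre fact displayed next to the letter. [cite: Balaban1985Variational, (28) p.282] -/
theorem star_JOfRecordAtBg_apply [Fact (0 < (F.L : ℝ))] [Fact (0 < (F.P K).eta k)]
    (b : Bond (F.P K).d (fun _ => (F.P K).sitesPerDir 0)) :
    star (NegSup.equiv (levWeight (F.L : ℝ) ((F.P K).eta k) (bondLevLit F Ω k) 3) (Matrix (Fin N) (Fin N) ℂ) (JOfRecordAtBg F N K k Ω U₀) b)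
      = NegSup.equiv (levWeight (F.L : ℝ) ((F.P K).eta k) (bondLevLit F Ω k) 3) (Matrix (Fin N) (Fin N) ℂ) (JOfRecordAtBg F N K k Ω U₀) b := by
  rw [JOfRecordAtBg_apply]
  have h := B11Eq27Current.J_eq_imPart_div (T := Tsh) (U := Ucur (unitsOfRecord F N U₀))
    (ucur_unitsOfRecord_inv_eq_star (F := F) (N := N) (U₀ := U₀)) ((F.P K).eta k) b.2 b.1
  rw [h, star_smul, B9Eq310Hermitian.star_eta_sq, star_imPart]

/-- ★ **(28) AT THE RECORD**: under the current clause of (2)∕(14) read bondwise (lit's named hypothesis `InU2cur`, radius `C₁B₃ε₁`),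
`‖J(U₀)‖₍₋₃₎ ≤ C₁B₃ε₁` — lit's `norm_Jcur_le` with its unitarity hypothesis discharged. [cite: Balaban1985Variational, (28) p.282, (14) p.280] -/
theorem norm_JOfRecordAtBg_le [Fact (0 < (F.L : ℝ))] [Fact (0 < (F.P K).eta k)] {C₁ B₃ ε₁ : ℝ} (hK : 0 ≤ C₁ * B₃ * ε₁)
    (h14 : InU2cur (F.L : ℝ) ((F.P K).eta k) (bondLevLit F Ω k) (C₁ * B₃ * ε₁) (unitsOfRecord F N U₀)) :
    ‖JOfRecordAtBg F N K k Ω U₀‖ ≤ C₁ * B₃ * ε₁ :=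
  B11Eq98CurrentSlot.norm_Jcur_le (unitsOfRecord F N U₀) (isUnitaryBg_unitsOfRecord) hK h14

/-! ## §3 E1: the letter at the unit background — `J(1) = 0` -/

/-- The unit background read on lit's bonds is the unit. [cite: Balaban1985BackgroundPropagators, (3.1) p.390] -/
theorem unitsOfRecord_one [NeZero N] : unitsOfRecord F N (1 : GaugeField (F.P K) 0 (SU N)) = 1 :=
  funext fun _ => Units.ext rfl

/-- **E1: `J(1) = 0`** — at the unit background every plaquette variable is `1`, `Im 1 = 0`, so the current vanishes (the first-order term of (26)
is absent at a flat background). [cite: Balaban1985Variational, (27)–(28) p.282] -/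
theorem JOfRecordAtBg_one [NeZero N] [Fact (0 < (F.L : ℝ))] [Fact (0 < (F.P K).eta k)] :
    JOfRecordAtBg F N K k Ω (1 : GaugeField (F.P K) 0 (SU N)) = 0 := by
  apply (NegSup.equiv (levWeight (F.L : ℝ) ((F.P K).eta k) (bondLevLit F Ω k) 3) (Matrix (Fin N) (Fin N) ℂ)).injective
  funext b
  rw [JOfRecordAtBg_apply, unitsOfRecord_one, NegSup.equiv_zero]
  simp [B9Eq39Adjoint.J, B9Eq39Adjoint.divPη, B9Eq39Adjoint.divP, B9Eq39Adjoint.plaqU, B9Eq37Insertion.imC, B9Eq39Adjoint.covDstar,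
    B9Eq39Adjoint.R, Ucur]

end Literature.MathematicalPhysics.QuantumFieldTheory.Balaban1983to89.Node00
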